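/-
Copyright (c) 2026 the pub-hodgecm-mathlib formalisation cell (harness21).  Literature-prover seat hodgecm-mathlib-B-typ04 (g34) («B-ROTA-1» (iii),
off-rota Literature discharger): the LOCAL INPUT «`|F^× ∕ N E^×| = 2` exactly» for an ABSTRACT `p`-adic field with an involution, 2026-09-04.
-/
import Literature.NumberTheory.Rogawski1990.Ch3Prop372Holds                 -- ★ p860317 (B-typ01 (g34)): `Ch3.valuation_map_eq_of_involutive` (σ preserves the valuation)
import Literature.NumberTheory.LocalFields.WildQuadraticDatumUnitNormIndexTwo -- ★ `WildQuadraticDatum.exists_unit_norm_dichotomy_of_isRamifiedQuadraticDatum` (tame + wild); brings `IsRamifiedQuadraticDatum`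
import Literature.NumberTheory.LocalFields.ValuedFixedFieldRamifiedOfNe       -- ★ `ValuedFixedFieldRamified.map_eq_self_of_fixed_uniformizer` (fixed uniformiser + residually trivial ⇒ `σ = id`)
import Literature.NumberTheory.LocalFields.UnramifiedQuadraticNormSurjective -- ★ `UnramifiedQuadraticNorm.exists_mul_map_eq_of_finite_residueField` (unramified: fixed units are norms)
import HarnessLib

/-!
# The norm index of a quadratic involution of a `p`-adic field is EXACTLY two: a `σ`-fixed non-norm `c`, and every `σ`-fixed `s ≠ 0` is a norm
# `z·σz` or `c⁻¹` times one (Serre, *Local Fields*, Ch. V §2 Prop. 3 Cor., §3 Cor. 3; Ch. XIV §2 — the local norm index theorem for `[E : F] = 2`)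

Topic `NumberTheory/LocalFields`; namespace `Literature.NumberTheory.LocalFields.LocalFieldInvolutionNorm`.  THEOREMS ONLY (kernel-checked;
no definition, no named fact, no `sorry`, no instance, no notation); count-neutral local algebra.  Cell `pub/hodgecm-mathlib`, seat B-typ04 (g34),
in support of the `p`-ADIC rows of the Rogawski carpets (★ `Rogawski1990.Ch3.Prop382` — claimed by B-typ01 (g34) —, ★ `Rogawski1990.Ch3Sec10to13.prop3132aPadic`,
…), whose one local input beyond field algebra is the dichotomy proved here.

THE STATEMENT.  `E` a non-archimedean local field of characteristic `0` (Mathlib `IsNonarchimedeanLocalField E`, `CharZero E`), `σ : E →+* E` an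
involution (`σ ∘ σ = id`, `σ ≠ id`), `F = E^σ`, `N z = z·σz`.  **`exists_fixed_nonnorm_dichotomy`**: there is a `σ`-fixed `c ≠ 0` which is NOT a
norm, and every `σ`-fixed `s ≠ 0` satisfies `s = N z` or `c·s = N z` for some `z` — i.e. `F^× = N E^× ⊔ c⁻¹·N E^×`, `[F^× : N E^×] = 2`.  Corollary
**`exists_eq_norm_mul_of_not_norm`**: two `σ`-fixed non-norms differ by a norm.  (The lower bound `[F^× : N E^×] ≥ 2` alone is ★
`Rogawski1990.Ch3.exists_fixed_ne_zero_not_norm` of B-typ01 (g34); this file adds the upper bound and packages both.)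

THE PROOF (assembled from tree theorems; Serre V §2–§3).  By ★ `Ch3.valuation_map_eq_of_involutive`, `σ` preserves the valuation `v` of `E`.
Work on the `ℤᵐ⁰`-valued copy `Valued.mk' (v ∘ valueGroupWithZeroIsoInt)` (same valuation ring, hence `𝔪`-adically complete with finite residue
field — Mathlib's `IsNonarchimedeanLocalField` API), with a uniformiser `ϖ`, `|ϖ| = exp(−1)`, and the fixed element `π = ϖ·σϖ` of order `2`;
norms have EVEN order (`|zσz| = |z|²`).  §1 is stated for any such valued field `K` (**`exists_fixed_nonnorm_dichotomy_valued`**):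
* UNRAMIFIED READING (a `σ`-FIXED uniformiser `y` exists).  Since `σ ≠ id`, ★ `ValuedFixedFieldRamified.map_eq_self_of_fixed_uniformizer` (a residually
  trivial isometric involution fixing a uniformiser is the identity) yields an integer `x` with `|x − σx| = 1`, so the restriction of `σ` to `𝒪`
  moves `x` by a unit and ★ `UnramifiedQuadraticNorm.exists_mul_map_eq_of_finite_residueField` (Serre V §2 Prop. 3 and Cor.: `U_F = N U_E`) makes
  every fixed UNIT a norm (**`exists_mul_map_eq_of_fixed_uniformizer`**).  Then `c := y` (odd order, not a norm) and a fixed `s` of order `n` is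
  `N(z)·y^{−n}`, a norm if `n` is even and `y⁻¹` times a norm if `n` is odd.
* RAMIFIED READING (no fixed uniformiser).  Then every fixed `x ≠ 0` has even order (else `x·π^j` is a fixed uniformiser), so `(σ, ϖ, d, t)` with
  `|ϖ − σϖ| = |ϖ|^d`, `|2| = |ϖ|^t` is a ramified quadratic datum ★ `UnitaryThreeFourFrame.IsRamifiedQuadraticDatum` (the construction of ★
  `Ch3Prop372Holds`), and ★ `WildQuadraticDatum.exists_unit_norm_dichotomy_of_isRamifiedQuadraticDatum` (Serre V §3 Cor. 2–3, tame and wild, PROVED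
  in the tree by the cell's FOUR-FRAME squad) gives a fixed unit `c` with `U_F ⊆ N ∪ c⁻¹N`; `c` is not a norm because a fixed non-norm unit exists
  (★ `exists_fixed_unit_not_norm_of_isRamifiedQuadraticDatum`); a fixed `s` of order `2n` is `u·π^{−n}` with `u` a fixed unit and `π^{−n} = N(ϖ^{−n})`.
§2 transfers §1 to `IsNonarchimedeanLocalField E` along the `ℤᵐ⁰`-copy (**`exists_fixed_nonnorm_dichotomy`**, **`exists_eq_norm_mul_of_not_norm`**).

HONEST LABEL: HC_CM is proved only modulo the 7 printed citations (2 remaining named inputs: hLiu418 = stmt-HodgeConjecture-24832, h413 =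
stmt-HodgeConjecture-24833) until rung 0 closes; this file is off that cone, count-neutral (0 definitions, 0 named facts, 0 sorry).

## References
* [Serre1979] J.-P. Serre, *Local Fields*, GTM 67 (1979), Ch. V §2 Prop. 3 and Corollary (unramified: `U_K = N U_L`), §3 Prop. 5 Cor. 2–3
  (ramified: `[U_K : N U_L] = 2`), Ch. XIV §2 (the local norm index).
* [NeukirchANT1999] J. Neukirch, *Algebraic Number Theory*, Grundlehren 322 (1999), Ch. V (1.3) (`(K^* : N L^*) = 2` for quadratic `L/K`).
* [Rogawski1990] J. D. Rogawski, *Automorphic Representations of Unitary Groups in Three Variables*, Ann. of Math. Stud. 123 (1990), §3.8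
  p. 31 («`𝒟(G_γ∕F)` is isomorphic to `F^*∕NE^*`», `p`-adic: order `2`).
-/

set_option autoImplicit false

noncomputable section

open WithZero
open scoped Valued

namespace Literature.NumberTheory.LocalFields.LocalFieldInvolutionNorm

open Literature.NumberTheory.Automorphic.UnitaryThreeFourFrame (IsRamifiedQuadraticDatum)

/-! ## §1 `ℤᵐ⁰`-valued fields with `𝔪`-adically complete valuation ring and finite residue field -/

section ValuedField

variable {K : Type} [Field K] [Valued K ℤᵐ⁰]

/-- Norms `z·σz` of an isometric `σ` have even order: `|z·σz| = |z|²`. [folklore] -/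
private theorem v_mul_map_eq_sq {σ : K →+* K} (hvσ : ∀ x, Valued.v (σ x) = Valued.v x) (z : K) :
    Valued.v (z * σ z) = Valued.v z ^ 2 := by
  rw [map_mul, hvσ, sq]

/-- An element of order `−1` (a uniformiser) is not a norm `z·σz` of an isometric `σ`. [cite: Serre1979, Ch. V §3 (norms have even order in a ramified extension; `v(N x) ∈ 2ℤ`)] -/
theorem mul_map_ne_of_v_eq_exp_neg_one {σ : K →+* K} (hvσ : ∀ x, Valued.v (σ x) = Valued.v x) {y : K}
    (hy : Valued.v y = exp (-1 : ℤ)) (z : K) : z * σ z ≠ y := by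
  intro h
  have h' := v_mul_map_eq_sq hvσ z
  rw [h, hy] at h'
  rcases eq_or_ne z 0 with rfl | hz
  · rw [map_zero, zero_pow two_ne_zero] at h'
    exact exp_ne_zero h'
  · have hz' : Valued.v z = exp (log (Valued.v z)) := (exp_log ((Valuation.ne_zero_iff _).2 hz)).symm
    rw [hz', ← exp_nsmul, nsmul_eq_mul] at h'
    have h'' := exp_injective h'
    omega

/-- **UNRAMIFIED READING — FIXED UNITS ARE NORMS.**  `K` a `ℤᵐ⁰`-valued field with `𝔪`-adically complete valuation ring and finite residue field,
`σ ≠ id` an isometric involution admitting a `σ`-FIXED uniformiser `y` (`|y| = exp(−1)`): every `σ`-fixed unit is `z·σz`.  (`σ` is not residually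
trivial by ★ `map_eq_self_of_fixed_uniformizer`, so its restriction to `𝒪` moves an integer by a unit, and ★ `exists_mul_map_eq_of_finite_residueField`
applies.) [cite: Serre1979, Ch. V §2 Prop. 3 and Corollary («`U_K = N U_L`»), Ch. I §4 Prop. 10] -/
theorem exists_mul_map_eq_of_fixed_uniformizer [IsAdicComplete 𝓂[K] 𝒪[K]] [Finite 𝓀[K]]
    {σ : K →+* K} (hσ : ∀ x, σ (σ x) = x) (hvσ : ∀ x, Valued.v (σ x) = Valued.v x) (hσ1 : ∃ x, σ x ≠ x)
    {y : K} (hσy : σ y = y) (hy : Valued.v y = exp (-1 : ℤ))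
    {u : K} (hσu : σ u = u) (hu : Valued.v u = 1) : ∃ z : K, z * σ z = u := by
  -- `σ` is not residually trivial
  have hres : ∃ x : K, Valued.v x ≤ 1 ∧ ¬ Valued.v (x - σ x) < 1 := by
    by_contra h
    push Not at h
    obtain ⟨x₀, hx₀⟩ := hσ1
    exact hx₀ (ValuedFixedFieldRamified.map_eq_self_of_fixed_uniformizer hσ hvσ h hσy hy x₀)
  obtain ⟨x, hx1, hxσ⟩ := hres
  have hxσ1 : Valued.v (σ x - x) = 1 := by
    rw [← neg_sub, Valuation.map_neg]
    exact le_antisymm ((Valuation.map_sub _ _ _).trans (max_le hx1 (by rw [hvσ]; exact hx1))) (not_lt.1 hxσ)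
  -- `σ` restricted to the valuation ring
  have hσO : ∀ a : 𝒪[K], σ (a : K) ∈ 𝒪[K] := fun a =>
    (Valuation.mem_integer_iff _ _).2 (by rw [hvσ]; exact (Valuation.mem_integer_iff _ _).1 a.2)
  let σO : 𝒪[K] →+* 𝒪[K] := (σ.comp (𝒪[K]).subtype).codRestrict 𝒪[K] hσO
  have hσO' : ∀ a : 𝒪[K], ((σO a : 𝒪[K]) : K) = σ a := fun _ => rfl
  have hσσ : ∀ a, σO (σO a) = a := fun a => Subtype.ext (by rw [hσO', hσO', hσ])
  have hint := Valuation.integer.integers (Valued.v : Valuation K ℤᵐ⁰)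
  set xO : 𝒪[K] := ⟨x, (Valuation.mem_integer_iff _ _).2 hx1⟩ with hxO_def
  have ha : IsUnit (σO xO - xO) := hint.isUnit_iff_valuation_eq_one.2 hxσ1
  set uO : 𝒪[K] := ⟨u, (Valuation.mem_integer_iff _ _).2 hu.le⟩ with huO_def
  have huO : IsUnit uO := hint.isUnit_iff_valuation_eq_one.2 hu
  have hσuO : σO uO = uO := Subtype.ext (by rw [hσO']; exact hσu)
  obtain ⟨s, hs⟩ := UnramifiedQuadraticNorm.exists_mul_map_eq_of_finite_residueField σO hσσ ha uO huO hσuO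
  refine ⟨(s : K), ?_⟩
  have h := congrArg (fun a : 𝒪[K] => (a : K)) hs
  simpa only [Subring.coe_mul, hσO'] using h

/-- **`[F^× : N K^×] = 2` EXACTLY, valued-field form.**  `K` a `ℤᵐ⁰`-valued field with `𝔪`-adically complete valuation ring and finite residue
field, `ϖ` a uniformiser, `2 ≠ 0`, `σ ≠ id` an isometric involution, `F = K^σ`: there is a `σ`-fixed `c ≠ 0` which is not a norm `z·σz`, and every
`σ`-fixed `s ≠ 0` is a norm or `c⁻¹` times a norm.  Unramified reading (a fixed uniformiser `y`): `c = y`, by ★ `exists_mul_map_eq_of_fixed_uniformizer`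
and the parity of the order; ramified reading (none): every fixed element has even order, `(σ, ϖ, d, t)` is a ramified quadratic datum, and `c` is
the unit of ★ `WildQuadraticDatum.exists_unit_norm_dichotomy_of_isRamifiedQuadraticDatum`, a non-norm by ★ `exists_fixed_unit_not_norm_of_isRamifiedQuadraticDatum`.
[cite: Serre1979, Ch. V §2 Prop. 3 Cor.; §3 Prop. 5 Cor. 2–3] [cite: NeukirchANT1999, Ch. V (1.3)] -/
theorem exists_fixed_nonnorm_dichotomy_valued [IsAdicComplete 𝓂[K] 𝒪[K]] [Finite 𝓀[K]]
    {σ : K →+* K} (hσ : ∀ x, σ (σ x) = x) (hvσ : ∀ x, Valued.v (σ x) = Valued.v x) (hσ1 : ∃ x, σ x ≠ x)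
    (h2 : (2 : K) ≠ 0) {ϖ : K} (hϖ : Valued.v ϖ = exp (-1 : ℤ)) :
    ∃ c : K, σ c = c ∧ c ≠ 0 ∧ (∀ z : K, z * σ z ≠ c) ∧
      ∀ s : K, σ s = s → s ≠ 0 → (∃ z : K, z * σ z = s) ∨ ∃ z : K, z * σ z = c * s := by
  have hϖ0 : ϖ ≠ 0 := (Valuation.ne_zero_iff _).1 (by rw [hϖ]; exact exp_ne_zero)
  have hexp : ∀ x : K, x ≠ 0 → Valued.v x = exp (log (Valued.v x)) := fun x hx =>
    (exp_log ((Valuation.ne_zero_iff _).2 hx)).symm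
  -- the fixed element `π = ϖ·σϖ` of order `2`
  have hσπ : σ (ϖ * σ ϖ) = ϖ * σ ϖ := by rw [map_mul, hσ, mul_comm]
  have hvπ : Valued.v (ϖ * σ ϖ) = exp (-2 : ℤ) := by
    rw [v_mul_map_eq_sq hvσ, hϖ, ← exp_nsmul]
    congr 1
  have hπ0 : ϖ * σ ϖ ≠ 0 := mul_ne_zero hϖ0 ((map_ne_zero σ).2 hϖ0)
  have hπpow : ∀ n : ℤ, (ϖ * σ ϖ) ^ n = ϖ ^ n * σ (ϖ ^ n) := fun n => by rw [map_zpow₀, mul_zpow]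
  by_cases hU : ∃ y : K, σ y = y ∧ Valued.v y = exp (-1 : ℤ)
  · /- UNRAMIFIED READING: `c = y` -/
    obtain ⟨y, hσy, hy⟩ := hU
    have hy0 : y ≠ 0 := (Valuation.ne_zero_iff _).1 (by rw [hy]; exact exp_ne_zero)
    refine ⟨y, hσy, hy0, mul_map_ne_of_v_eq_exp_neg_one hvσ hy, fun s hσs hs0 => ?_⟩
    set n : ℤ := log (Valued.v s) with hn_def
    have hsn : Valued.v s = exp n := hexp s hs0
    -- `u = s·yⁿ` is a fixed unit, hence a norm
    have hσu : σ (s * y ^ n) = s * y ^ n := by rw [map_mul, map_zpow₀, hσs, hσy]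
    have hvu : Valued.v (s * y ^ n) = 1 := by
      rw [map_mul, map_zpow₀, hsn, hy, ← exp_zsmul, ← exp_add, smul_eq_mul, ← exp_zero]
      congr 1
      ring
    obtain ⟨z, hz⟩ := exists_mul_map_eq_of_fixed_uniformizer hσ hvσ hσ1 hσy hy hσu hvu
    have hσyp : ∀ k : ℤ, σ (y ^ k) = y ^ k := fun k => by rw [map_zpow₀, hσy]
    rcases Int.even_or_odd n with ⟨m, hm⟩ | ⟨m, hm⟩
    · refine Or.inl ⟨z * y ^ (-m), ?_⟩
      calc z * y ^ (-m) * σ (z * y ^ (-m)) = (z * σ z) * (y ^ (-m) * y ^ (-m)) := by rw [map_mul, hσyp]; ring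
        _ = s * (y ^ n * (y ^ (-m) * y ^ (-m))) := by rw [hz]; ring
        _ = s := by rw [← zpow_add₀ hy0, ← zpow_add₀ hy0, hm, show m + m + (-m + -m) = 0 by ring, zpow_zero, mul_one]
    · refine Or.inr ⟨z * y ^ (-m), ?_⟩
      calc z * y ^ (-m) * σ (z * y ^ (-m)) = (z * σ z) * (y ^ (-m) * y ^ (-m)) := by rw [map_mul, hσyp]; ring
        _ = s * (y ^ n * (y ^ (-m) * y ^ (-m))) := by rw [hz]; ring
        _ = y * s := by
          rw [← zpow_add₀ hy0, ← zpow_add₀ hy0, hm, show 2 * m + 1 + (-m + -m) = 1 by ring, zpow_one, mul_comm]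
  · /- RAMIFIED READING: every fixed `x ≠ 0` has even order, `(σ, ϖ, d, t)` is a ramified quadratic datum -/
    push Not at hU
    have hfix : ∀ x : K, σ x = x → x ≠ 0 → ∃ n : ℤ, Valued.v x = exp (2 * n) := by
      intro x hσx hx0
      set k : ℤ := log (Valued.v x) with hk_def
      have hk : Valued.v x = exp k := hexp x hx0
      rcases Int.even_or_odd k with ⟨n, hn⟩ | ⟨n, hn⟩
      · exact ⟨n, by rw [hk, hn, two_mul]⟩
      · exfalso
        refine hU (x * (ϖ * σ ϖ) ^ (n + 1)) (by rw [map_mul, map_zpow₀, hσx, hσπ]) ?_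
        rw [map_mul, map_zpow₀, hk, hvπ, ← exp_zsmul, ← exp_add, smul_eq_mul, hn]
        congr 1
        ring
    -- the datum (as in ★ `Ch3Prop372Holds.exists_fixed_ne_zero_not_norm`)
    have hσϖ : σ ϖ ≠ ϖ := fun h => hU ϖ h hϖ
    have hsub0 : ϖ - σ ϖ ≠ 0 := sub_ne_zero.2 (Ne.symm hσϖ)
    have hdle : Valued.v (ϖ - σ ϖ) ≤ exp (-1 : ℤ) :=
      (Valuation.map_sub _ _ _).trans (by rw [hvσ, max_self, hϖ])
    set m : ℤ := log (Valued.v (ϖ - σ ϖ)) with hm_def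
    have hmexp : Valued.v (ϖ - σ ϖ) = exp m := hexp _ hsub0
    have hm1 : m ≤ -1 := by rw [hmexp, exp_le_exp] at hdle; exact hdle
    set m₂ : ℤ := log (Valued.v (2 : K)) with hm₂_def
    have hm₂exp : Valued.v (2 : K) = exp m₂ := hexp _ h2
    have hm₂0 : m₂ ≤ 0 := by
      have h : Valued.v (2 : K) ≤ 1 := by
        have : Valued.v ((1 : K) + 1) ≤ max (Valued.v (1 : K)) (Valued.v (1 : K)) := Valuation.map_add _ _ _
        rwa [map_one, max_self, one_add_one_eq_two] at this
      rwa [hm₂exp, ← exp_zero, exp_le_exp] at h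
    have hD : IsRamifiedQuadraticDatum σ ϖ (-m).toNat (-m₂).toNat := by
      refine ⟨hσ, hvσ, hϖ, hfix, ?_, by omega, ?_⟩
      · rw [hmexp, hϖ, ← exp_nsmul, nsmul_eq_mul]
        congr 1
        omega
      · rw [hm₂exp, hϖ, ← exp_nsmul, nsmul_eq_mul]
        congr 1
        omega
    obtain ⟨c, hσc, hvc, hdich⟩ := WildQuadraticDatum.exists_unit_norm_dichotomy_of_isRamifiedQuadraticDatum σ ϖ _ _ hD
    obtain ⟨u₀, hσu₀, hvu₀, hu₀⟩ := WildQuadraticDatum.exists_fixed_unit_not_norm_of_isRamifiedQuadraticDatum σ ϖ _ _ hD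
    have hc0 : c ≠ 0 := (Valuation.ne_zero_iff _).1 (by rw [hvc]; exact one_ne_zero)
    -- `c` is not a norm: otherwise the non-norm unit `u₀` would be one
    have hcn : ∀ z : K, z * σ z ≠ c := by
      intro z hz
      rcases hdich u₀ hσu₀ hvu₀ with ⟨w, hw⟩ | ⟨w, hw⟩
      · exact hu₀ ⟨w, hw⟩
      · have hz0 : z ≠ 0 := by
          rintro rfl
          rw [zero_mul] at hz
          exact hc0 hz.symm
        refine hu₀ ⟨w / z, ?_⟩
        rw [map_div₀, div_mul_div_comm, hw, hz, mul_div_cancel_left₀ _ hc0]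
    refine ⟨c, hσc, hc0, hcn, fun s hσs hs0 => ?_⟩
    obtain ⟨n, hn⟩ := hfix s hσs hs0
    -- `u = s·πⁿ` is a fixed unit
    have hσu : σ (s * (ϖ * σ ϖ) ^ n) = s * (ϖ * σ ϖ) ^ n := by rw [map_mul, map_zpow₀, hσs, hσπ]
    have hvu : Valued.v (s * (ϖ * σ ϖ) ^ n) = 1 := by
      rw [map_mul, map_zpow₀, hn, hvπ, ← exp_zsmul, ← exp_add, smul_eq_mul, ← exp_zero]
      congr 1
      ring
    have hback : ∀ z : K, (z * ϖ ^ (-n)) * σ (z * ϖ ^ (-n)) = (z * σ z) * (ϖ * σ ϖ) ^ (-n) :=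
      fun z => by rw [hπpow (-n), map_mul]; ring
    rcases hdich _ hσu hvu with ⟨z, hz⟩ | ⟨z, hz⟩
    · refine Or.inl ⟨z * ϖ ^ (-n), ?_⟩
      rw [hback z, hz, mul_assoc, ← zpow_add₀ hπ0, add_neg_cancel, zpow_zero, mul_one]
    · refine Or.inr ⟨z * ϖ ^ (-n), ?_⟩
      rw [hback z, hz, mul_assoc, mul_assoc, ← zpow_add₀ hπ0, add_neg_cancel, zpow_zero, mul_one]

/-- Corollary (valued form): two `σ`-fixed non-norms differ by a norm — `t = N(z)·s`. [cite: Serre1979, Ch. V §3 Prop. 5 Cor. 3] -/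
theorem exists_eq_norm_mul_of_not_norm_valued [IsAdicComplete 𝓂[K] 𝒪[K]] [Finite 𝓀[K]]
    {σ : K →+* K} (hσ : ∀ x, σ (σ x) = x) (hvσ : ∀ x, Valued.v (σ x) = Valued.v x) (hσ1 : ∃ x, σ x ≠ x)
    (h2 : (2 : K) ≠ 0) {ϖ : K} (hϖ : Valued.v ϖ = exp (-1 : ℤ))
    {s t : K} (hσs : σ s = s) (hs0 : s ≠ 0) (hsn : ∀ z : K, z * σ z ≠ s)
    (hσt : σ t = t) (ht0 : t ≠ 0) (htn : ∀ z : K, z * σ z ≠ t) :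
    ∃ z : K, t = z * σ z * s := by
  obtain ⟨c, -, hc0, -, hdich⟩ := exists_fixed_nonnorm_dichotomy_valued hσ hvσ hσ1 h2 hϖ
  obtain ⟨z₁, hz₁⟩ : ∃ z : K, z * σ z = c * s := (hdich s hσs hs0).resolve_left (fun ⟨z, hz⟩ => hsn z hz)
  obtain ⟨z₂, hz₂⟩ : ∃ z : K, z * σ z = c * t := (hdich t hσt ht0).resolve_left (fun ⟨z, hz⟩ => htn z hz)
  have hz₁0 : z₁ ≠ 0 := by
    rintro rfl
    rw [zero_mul] at hz₁
    exact mul_ne_zero hc0 hs0 hz₁.symm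
  refine ⟨z₂ / z₁, ?_⟩
  rw [map_div₀, div_mul_div_comm, hz₁, hz₂]
  field_simp

end ValuedField

/-! ## §2 Non-archimedean local fields (Mathlib `IsNonarchimedeanLocalField`) -/

section LocalField

open ValuativeRel

variable {E : Type} [Field E] [ValuativeRel E] [TopologicalSpace E] [IsNonarchimedeanLocalField E]

omit [ValuativeRel E] [TopologicalSpace E] [IsNonarchimedeanLocalField E] in
/-- `IsAdicComplete 𝔪 A` transported along an equality of subrings. [folklore] -/
private theorem isAdicComplete_of_subring_eq {A B : Subring E} (h : B = A) [IsLocalRing A] [IsLocalRing B]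
    (hA : IsAdicComplete (IsLocalRing.maximalIdeal A) A) : IsAdicComplete (IsLocalRing.maximalIdeal B) B := by
  subst h
  exact hA

omit [ValuativeRel E] [TopologicalSpace E] [IsNonarchimedeanLocalField E] in
/-- Finiteness of the residue field transported along an equality of subrings. [folklore] -/
private theorem finite_residueField_of_subring_eq {A B : Subring E} (h : B = A) [IsLocalRing A] [IsLocalRing B]
    (hA : Finite (IsLocalRing.ResidueField A)) : Finite (IsLocalRing.ResidueField B) := by
  subst h
  exact hA

/-- The valuation ring of a non-archimedean local field is `𝔪`-adically complete (Mathlib, through the canonical uniform structure). [folklore] -/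
private theorem isAdicComplete_valuativeRel_integer :
    IsAdicComplete (IsLocalRing.maximalIdeal (valuation E).integer) (valuation E).integer := by
  letI := IsTopologicalAddGroup.rightUniformSpace E
  haveI := isUniformAddGroup_of_addCommGroup (G := E)
  infer_instance

/-- **`[F^× : N E^×] = 2` EXACTLY for an involution of a `p`-adic field.**  `E` a non-archimedean local field of characteristic `0`, `σ` an
involution of `E` with `σ ≠ id`, `F = E^σ`, `N z = z·σz`: there is a `σ`-fixed `c ≠ 0` which is not a norm, and every `σ`-fixed `s ≠ 0` is `N z`
or satisfies `c·s = N z` — `F^× = N E^× ⊔ c⁻¹ N E^×`.  (★ `exists_fixed_nonnorm_dichotomy_valued` on the `ℤᵐ⁰`-copy of the valuation, `σ` being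
isometric by ★ `Rogawski1990.Ch3.valuation_map_eq_of_involutive`.) [cite: Serre1979, Ch. V §2 Prop. 3 Cor., §3 Prop. 5 Cor. 3; Ch. XIV §2]
[cite: NeukirchANT1999, Ch. V (1.3)] [cite: Rogawski1990, §3.8 p. 31 («`F^*∕NE^*`» of order two)] -/
theorem exists_fixed_nonnorm_dichotomy [CharZero E] (σ : E →+* E) (hσ : ∀ x, σ (σ x) = x) (hσ1 : σ ≠ RingHom.id E) :
    ∃ c : E, σ c = c ∧ c ≠ 0 ∧ (∀ z : E, z * σ z ≠ c) ∧
      ∀ s : E, σ s = s → s ≠ 0 → (∃ z : E, z * σ z = s) ∨ ∃ z : E, z * σ z = c * s := by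
  classical
  have hvσ := Literature.NumberTheory.Rogawski1990.Ch3.valuation_map_eq_of_involutive σ hσ
  have hσ1' : ∃ x, σ x ≠ x := by
    by_contra h
    push Not at h
    exact hσ1 (RingHom.ext h)
  -- the `ℤᵐ⁰`-valued copy of the valuation
  let iso := IsNonarchimedeanLocalField.valueGroupWithZeroIsoInt E
  let v' : Valuation E ℤᵐ⁰ := (valuation E).map (MonoidWithZeroHom.ofClass iso) (OrderHomClass.mono iso)
  letI : Valued E ℤᵐ⁰ := Valued.mk' v'
  have hv' : ∀ x, Valued.v x = iso (valuation E x) := fun x => by rfl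
  have hle1 : ∀ γ : ValueGroupWithZero E, iso γ ≤ 1 ↔ γ ≤ 1 := fun γ => by
    rw [← map_one iso]; exact map_le_map_iff iso
  have hO : Valued.integer E = (valuation E).integer := by
    ext x
    rw [Valued.integer, Valuation.mem_integer_iff, Valuation.mem_integer_iff, hv', hle1]
  haveI : IsAdicComplete (IsLocalRing.maximalIdeal (Valued.integer E)) (Valued.integer E) :=
    isAdicComplete_of_subring_eq hO isAdicComplete_valuativeRel_integer
  haveI : Finite (IsLocalRing.ResidueField (Valued.integer E)) :=
    finite_residueField_of_subring_eq hO inferInstance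
  have hvσ' : ∀ a, Valued.v (σ a) = Valued.v a := fun a => by rw [hv', hv', hvσ]
  -- a uniformiser of the copy
  obtain ⟨ϖ, hϖ⟩ := ValuativeRel.valuation_surjective (iso.symm (exp (-1 : ℤ)))
  have hvϖ : Valued.v ϖ = exp (-1 : ℤ) := by rw [hv', hϖ]; exact iso.apply_symm_apply _
  exact exists_fixed_nonnorm_dichotomy_valued hσ hvσ' hσ1' two_ne_zero hvϖ

/-- **TWO `σ`-FIXED NON-NORMS DIFFER BY A NORM**: `t = N(z)·s` — the index `[F^× : N E^×]` is at most two. [cite: Serre1979, Ch. V §3 Prop. 5 Cor. 3; Ch. XIV §2]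
[cite: NeukirchANT1999, Ch. V (1.3)] -/
theorem exists_eq_norm_mul_of_not_norm [CharZero E] (σ : E →+* E) (hσ : ∀ x, σ (σ x) = x) (hσ1 : σ ≠ RingHom.id E)
    {s t : E} (hσs : σ s = s) (hs0 : s ≠ 0) (hsn : ∀ z : E, z * σ z ≠ s)
    (hσt : σ t = t) (ht0 : t ≠ 0) (htn : ∀ z : E, z * σ z ≠ t) :
    ∃ z : E, t = z * σ z * s := by
  obtain ⟨c, -, hc0, -, hdich⟩ := exists_fixed_nonnorm_dichotomy σ hσ hσ1
  obtain ⟨z₁, hz₁⟩ : ∃ z : E, z * σ z = c * s := (hdich s hσs hs0).resolve_left (fun ⟨z, hz⟩ => hsn z hz)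
  obtain ⟨z₂, hz₂⟩ : ∃ z : E, z * σ z = c * t := (hdich t hσt ht0).resolve_left (fun ⟨z, hz⟩ => htn z hz)
  have hz₁0 : z₁ ≠ 0 := by
    rintro rfl
    rw [zero_mul] at hz₁
    exact mul_ne_zero hc0 hs0 hz₁.symm
  refine ⟨z₂ / z₁, ?_⟩
  rw [map_div₀, div_mul_div_comm, hz₁, hz₂]
  field_simp

/-- **EVERY `σ`-FIXED NON-NORM REPRESENTS THE NON-TRIVIAL CLASS**: if `c` is a fixed non-norm then every fixed `s ≠ 0` is `N z` or `c·s = N z`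
(the dichotomy of ★ `exists_fixed_nonnorm_dichotomy` holds for ANY fixed non-norm `c`, e.g. the one of ★ `Rogawski1990.Ch3.exists_fixed_ne_zero_not_norm`).
[cite: Serre1979, Ch. V §3 Prop. 5 Cor. 3; Ch. XIV §2] -/
theorem norm_dichotomy_of_not_norm [CharZero E] (σ : E →+* E) (hσ : ∀ x, σ (σ x) = x) (hσ1 : σ ≠ RingHom.id E)
    {c : E} (hσc : σ c = c) (hc0 : c ≠ 0) (hcn : ∀ z : E, z * σ z ≠ c)
    {s : E} (hσs : σ s = s) (hs0 : s ≠ 0) : (∃ z : E, z * σ z = s) ∨ ∃ z : E, z * σ z = c * s := by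
  by_cases hs : ∃ z : E, z * σ z = s
  · exact Or.inl hs
  · push Not at hs
    obtain ⟨z, hz⟩ := exists_eq_norm_mul_of_not_norm σ hσ hσ1 hσc hc0 hcn hσs hs0 hs
    -- `s = N z · c`, so `c·s = N(z·c)`
    refine Or.inr ⟨z * c, ?_⟩
    rw [map_mul, hσc, hz]
    ring

end LocalField

end Literature.NumberTheory.LocalFields.LocalFieldInvolutionNorm

end
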